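import Mathlib
import Summits.Ventures.Crystal3D.Theorems.StickyWulffConstantTextureLiminfTentHat
import HarnessLib

/-!
# The tent certificate for fcc grains — the hat functions are AFFINE on every chamber (eng g8)

Route `StickyWulffConstant` (`Summits/Ventures/Crystal3D`, cell `crystal3d-full`), support toward the crux
`TextureLiminf` (stmt-Ventures-19483), FREE half (tent certificate, TexShadow v6.1).  Core of the
piecewise-affinity of the tent `f_X` (`…TentHatDefs.lean`): on a closed chamber
`{κ_i ≤ y_i ≤ κ_i + 1, 2μ_j ≤ ⟪a_j, y⟫ ≤ 2μ_j + 2}` (lattice-centred; hole-centred windows are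
`[2ν_j − 1, 2ν_j + 1]`) the coordinate signs, the dominance comparisons `|y_i| ≷ |y_j| + |y_k|` (a `±1`
combination of the coordinates is `±` a `(111)` functional, `exists_normal4_of_signs`,
`sign_decided_of_signs`) and the level comparison (`abs_le_one_or_one_le_abs`) are all decided by the
integer label, so `hatL` (`exists_affine_hatL`) and `hatH` (`exists_affine_hatH`) coincide with ONE
affine function on the whole chamber.
WHAT THIS IS NOT: the complex / the certificate; F-C1 not moved.
-/

noncomputable section

namespace Summit.Ventures.Crystal3D.TentCertificate

open Finset Summit.Ventures.Crystal3D MeasureTheory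
open Literature.Geometry.DiscreteGeometry (intVec intVec_apply)
open scoped RealInnerProductSpace

/-! ## Affinity of the hat functions on every chamber -/

/-- `⟪intVec a, y⟫` in coordinates. -/
theorem inner_intVec_left (a : Site) (y : EuclideanSpace ℝ (Fin 3)) :
    ⟪intVec a, y⟫ = (a 0 : ℝ) * y 0 + (a 1 : ℝ) * y 1 + (a 2 : ℝ) * y 2 := by
  simp [PiLp.inner_apply, intVec_apply, Fin.sum_univ_three, mul_comm]

/-- Every `±1` vector is `±` one of the four `(111)` normals. -/
theorem exists_normal4_of_signs (σ : Fin 3 → ℝ) (hσ : ∀ i, σ i = 1 ∨ σ i = -1) :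
    ∃ j : Fin 4, ∃ ε : ℝ, (ε = 1 ∨ ε = -1) ∧ ∀ i, σ i = ε * (normal4 j i : ℝ) := by
  rcases hσ 0 with h0 | h0 <;> rcases hσ 1 with h1 | h1 <;> rcases hσ 2 with h2 | h2
  · exact ⟨0, 1, Or.inl rfl, fun i => by fin_cases i <;> simp [normal4, h0, h1, h2]⟩
  · exact ⟨1, 1, Or.inl rfl, fun i => by fin_cases i <;> simp [normal4, h0, h1, h2]⟩
  · exact ⟨2, 1, Or.inl rfl, fun i => by fin_cases i <;> simp [normal4, h0, h1, h2]⟩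
  · exact ⟨3, -1, Or.inr rfl, fun i => by fin_cases i <;> simp [normal4, h0, h1, h2]⟩
  · exact ⟨3, 1, Or.inl rfl, fun i => by fin_cases i <;> simp [normal4, h0, h1, h2]⟩
  · exact ⟨2, -1, Or.inr rfl, fun i => by fin_cases i <;> simp [normal4, h0, h1, h2]⟩
  · exact ⟨1, -1, Or.inr rfl, fun i => by fin_cases i <;> simp [normal4, h0, h1, h2]⟩
  · exact ⟨0, -1, Or.inr rfl, fun i => by fin_cases i <;> simp [normal4, h0, h1, h2]⟩

/-- A `±1` combination of the coordinates is `±` a `(111)` functional, hence has a DECIDED SIGN on every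
chamber window `2μ_j ≤ ⟪a_j, y⟫ ≤ 2μ_j + 2`. -/
theorem sign_decided_of_signs (τ : Fin 3 → ℝ) (hτ : ∀ i, τ i = 1 ∨ τ i = -1) (μ : Fin 4 → ℤ) :
    (∀ y : EuclideanSpace ℝ (Fin 3), (∀ j, 2 * (μ j : ℝ) ≤ ⟪intVec (normal4 j), y⟫ ∧
        ⟪intVec (normal4 j), y⟫ ≤ 2 * μ j + 2) → 0 ≤ τ 0 * y 0 + τ 1 * y 1 + τ 2 * y 2) ∨
    (∀ y : EuclideanSpace ℝ (Fin 3), (∀ j, 2 * (μ j : ℝ) ≤ ⟪intVec (normal4 j), y⟫ ∧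
        ⟪intVec (normal4 j), y⟫ ≤ 2 * μ j + 2) → τ 0 * y 0 + τ 1 * y 1 + τ 2 * y 2 ≤ 0) := by
  obtain ⟨j, ε, hε, hτε⟩ := exists_normal4_of_signs τ hτ
  have hsum : ∀ y : EuclideanSpace ℝ (Fin 3), τ 0 * y 0 + τ 1 * y 1 + τ 2 * y 2 =
      ε * ⟪intVec (normal4 j), y⟫ := by
    intro y; rw [inner_intVec_left, hτε 0, hτε 1, hτε 2]; ring
  rcases hε with rfl | rfl
  · rcases le_or_gt 0 (μ j) with hμ | hμ
    · left; intro y hy; rw [hsum]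
      have : (0 : ℝ) ≤ μ j := by exact_mod_cast hμ
      linarith [(hy j).1]
    · right; intro y hy; rw [hsum]
      have : (μ j : ℝ) + 1 ≤ 0 := by exact_mod_cast (by omega : μ j + 1 ≤ 0)
      linarith [(hy j).2]
  · rcases le_or_gt 0 (μ j) with hμ | hμ
    · right; intro y hy; rw [hsum]
      have : (0 : ℝ) ≤ μ j := by exact_mod_cast hμ
      linarith [(hy j).1]
    · left; intro y hy; rw [hsum]
      have : (μ j : ℝ) + 1 ≤ 0 := by exact_mod_cast (by omega : μ j + 1 ≤ 0)
      linarith [(hy j).2]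

/-- Signs of the coordinates on a chamber box `κ_i ≤ y_i ≤ κ_i + 1`: `|y_i| = σ_i y_i` with
`σ_i = 1` if `κ_i ≥ 0` and `σ_i = −1` otherwise. -/
theorem abs_eq_sign_mul {κ : Fin 3 → ℤ} {y : EuclideanSpace ℝ (Fin 3)}
    (hy : ∀ i, (κ i : ℝ) ≤ y i ∧ y i ≤ κ i + 1) (i : Fin 3) :
    |y i| = (if 0 ≤ κ i then (1 : ℝ) else -1) * y i := by
  split_ifs with h
  · have h' : (0 : ℝ) ≤ (κ i : ℝ) := by exact_mod_cast h
    rw [one_mul]; exact abs_of_nonneg (le_trans h' (hy i).1)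
  · push Not at h
    have : (κ i : ℝ) + 1 ≤ 0 := by exact_mod_cast (by omega : κ i + 1 ≤ 0)
    rw [neg_one_mul]; exact abs_of_nonpos (le_trans (hy i).2 this)

/-- The level comparison `|y_i| ≤ 1` / `|y_i| ≥ 1` is decided on a chamber box. -/
theorem abs_le_one_or_one_le_abs (κ : Fin 3 → ℤ) (i : Fin 3) :
    (∀ y : EuclideanSpace ℝ (Fin 3), (∀ i, (κ i : ℝ) ≤ y i ∧ y i ≤ κ i + 1) → |y i| ≤ 1) ∨
    (∀ y : EuclideanSpace ℝ (Fin 3), (∀ i, (κ i : ℝ) ≤ y i ∧ y i ≤ κ i + 1) → 1 ≤ |y i|) := by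
  by_cases h0 : κ i = 0
  · left; intro y hy
    have h1 := (hy i).1; have h2 := (hy i).2
    rw [h0] at h1 h2; push_cast at h1 h2
    rw [abs_le]; constructor <;> linarith
  by_cases h1 : κ i = -1
  · left; intro y hy
    have ha := (hy i).1; have hb := (hy i).2
    rw [h1] at ha hb; push_cast at ha hb
    rw [abs_le]; constructor <;> linarith
  right; intro y hy
  have ha := (hy i).1; have hb := (hy i).2
  rcases le_or_gt 1 (κ i) with h | h
  · have : (1 : ℝ) ≤ κ i := by exact_mod_cast h
    rw [le_abs]; left; linarith
  · have : (κ i : ℝ) + 1 ≤ -1 := by exact_mod_cast (by omega : κ i + 1 ≤ -1)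
    rw [le_abs]; right; linarith

/-- **The lattice hat function is affine on every (lattice-centred) closed chamber**
`{κ_i ≤ y_i ≤ κ_i + 1, 2μ_j ≤ ⟪a_j, y⟫ ≤ 2μ_j + 2}`: the coordinate signs, the dominance comparisons
`|y_i| ≷ |y_j| + |y_k|` (a `(111)` functional once the signs are fixed) and the level comparison are all
decided by the label. -/
theorem exists_affine_hatL (κ : Fin 3 → ℤ) (μ : Fin 4 → ℤ) :
    ∃ g : EuclideanSpace ℝ (Fin 3), ∃ b : ℝ, ∀ y : EuclideanSpace ℝ (Fin 3),
      (∀ i, (κ i : ℝ) ≤ y i ∧ y i ≤ κ i + 1) →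
      (∀ j, 2 * (μ j : ℝ) ≤ ⟪intVec (normal4 j), y⟫ ∧ ⟪intVec (normal4 j), y⟫ ≤ 2 * μ j + 2) →
      hatL y = ⟪g, y⟫ + b := by
  classical
  set σ : Fin 3 → ℝ := fun i => if 0 ≤ κ i then (1 : ℝ) else -1 with hσ
  have hσ1 : ∀ i, σ i = 1 ∨ σ i = -1 := fun i => by
    simp only [hσ]; split_ifs <;> simp
  have habs : ∀ y : EuclideanSpace ℝ (Fin 3), (∀ i, (κ i : ℝ) ≤ y i ∧ y i ≤ κ i + 1) →
      ∀ i, |y i| = σ i * y i := fun y hy i => abs_eq_sign_mul hy i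
  -- the dominance functionals `D_i = |y_i| - |y_j| - |y_k|` as ±1 combinations
  set τ : Fin 3 → Fin 3 → ℝ := fun i l => if l = i then σ l else -σ l with hτ
  have hτ1 : ∀ i l, τ i l = 1 ∨ τ i l = -1 := by
    intro i l; simp only [hτ]
    split_ifs
    · exact hσ1 l
    · rcases hσ1 l with h | h <;> simp [h]
  have hD : ∀ y : EuclideanSpace ℝ (Fin 3), (∀ i, (κ i : ℝ) ≤ y i ∧ y i ≤ κ i + 1) → ∀ i,
      τ i 0 * y 0 + τ i 1 * y 1 + τ i 2 * y 2 =
        2 * |y i| - (|y 0| + |y 1| + |y 2|) := by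
    intro y hy i
    rw [habs y hy 0, habs y hy 1, habs y hy 2, habs y hy i]
    fin_cases i <;> simp [hτ] <;> ring
  have hdec := fun i => sign_decided_of_signs (τ i) (hτ1 i) μ
  by_cases hA : ∃ i, ∀ y : EuclideanSpace ℝ (Fin 3),
      (∀ j, 2 * (μ j : ℝ) ≤ ⟪intVec (normal4 j), y⟫ ∧ ⟪intVec (normal4 j), y⟫ ≤ 2 * μ j + 2) →
      0 ≤ τ i 0 * y 0 + τ i 1 * y 1 + τ i 2 * y 2
  · -- Case A: coordinate `i` dominates on the chamber: `cubo y = |y i| = σ i * y i`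
    obtain ⟨i, hi⟩ := hA
    have hcubo : ∀ y : EuclideanSpace ℝ (Fin 3), (∀ i, (κ i : ℝ) ≤ y i ∧ y i ≤ κ i + 1) →
        (∀ j, 2 * (μ j : ℝ) ≤ ⟪intVec (normal4 j), y⟫ ∧ ⟪intVec (normal4 j), y⟫ ≤ 2 * μ j + 2) →
        cubo y = |y i| := by
      intro y hy hy'
      have h := hi y hy'
      rw [hD y hy i] at h
      fin_cases i
      · exact cubo_eq_abs₀ (by simp at h ⊢; linarith)
      · exact cubo_eq_abs₁ (by simp at h ⊢; linarith)
      · exact cubo_eq_abs₂ (by simp at h ⊢; linarith)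
    rcases abs_le_one_or_one_le_abs κ i with hle | hge
    · refine ⟨-(σ i • EuclideanSpace.single i (1 : ℝ)), 1, fun y hy hy' => ?_⟩
      rw [hatL, hcubo y hy hy', max_eq_right (by linarith [hle y hy]), habs y hy i, inner_neg_left,
        real_inner_smul_left, EuclideanSpace.inner_single_left]
      simp
      ring
    · refine ⟨0, 0, fun y hy hy' => ?_⟩
      rw [hatL, hcubo y hy hy', max_eq_left (by linarith [hge y hy]), inner_zero_left, add_zero]
  · -- Case B: no coordinate dominates: `cubo y = ‖y‖₁ / 2 = (Σ σ_i y_i)/2`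
    push Not at hA
    have hB : ∀ i, ∀ y : EuclideanSpace ℝ (Fin 3),
        (∀ j, 2 * (μ j : ℝ) ≤ ⟪intVec (normal4 j), y⟫ ∧ ⟪intVec (normal4 j), y⟫ ≤ 2 * μ j + 2) →
        τ i 0 * y 0 + τ i 1 * y 1 + τ i 2 * y 2 ≤ 0 := by
      intro i
      rcases hdec i with h | h
      · obtain ⟨y, hy, hlt⟩ := hA i
        exact absurd (h y hy) (not_le.2 hlt)
      · exact h
    have hcubo : ∀ y : EuclideanSpace ℝ (Fin 3), (∀ i, (κ i : ℝ) ≤ y i ∧ y i ≤ κ i + 1) →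
        (∀ j, 2 * (μ j : ℝ) ≤ ⟪intVec (normal4 j), y⟫ ∧ ⟪intVec (normal4 j), y⟫ ≤ 2 * μ j + 2) →
        cubo y = (σ 0 * y 0 + σ 1 * y 1 + σ 2 * y 2) / 2 := by
      intro y hy hy'
      have h0 := hB 0 y hy'; have h1 := hB 1 y hy'; have h2 := hB 2 y hy'
      rw [hD y hy] at h0 h1 h2
      rw [cubo_eq_half (by linarith) (by linarith) (by linarith), habs y hy 0, habs y hy 1, habs y hy 2]
    obtain ⟨ℓ, ε, hε, hSε⟩ := exists_normal4_of_signs σ hσ1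
    have hS : ∀ y : EuclideanSpace ℝ (Fin 3), σ 0 * y 0 + σ 1 * y 1 + σ 2 * y 2 =
        ε * ⟪intVec (normal4 ℓ), y⟫ := by
      intro y; rw [inner_intVec_left, hSε 0, hSε 1, hSε 2]; ring
    -- the level comparison `Σ σ_i y_i ≷ 2`
    have hlev : (∀ y : EuclideanSpace ℝ (Fin 3),
        (∀ j, 2 * (μ j : ℝ) ≤ ⟪intVec (normal4 j), y⟫ ∧ ⟪intVec (normal4 j), y⟫ ≤ 2 * μ j + 2) →
          ε * ⟪intVec (normal4 ℓ), y⟫ ≤ 2) ∨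
        (∀ y : EuclideanSpace ℝ (Fin 3),
        (∀ j, 2 * (μ j : ℝ) ≤ ⟪intVec (normal4 j), y⟫ ∧ ⟪intVec (normal4 j), y⟫ ≤ 2 * μ j + 2) →
          2 ≤ ε * ⟪intVec (normal4 ℓ), y⟫) := by
      rcases hε with rfl | rfl
      · rcases le_or_gt (μ ℓ) 0 with hμ | hμ
        · left; intro y hy
          have : (μ ℓ : ℝ) ≤ 0 := by exact_mod_cast hμ
          linarith [(hy ℓ).2]
        · right; intro y hy
          have : (1 : ℝ) ≤ μ ℓ := by exact_mod_cast hμ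
          linarith [(hy ℓ).1]
      · rcases le_or_gt (-1) (μ ℓ) with hμ | hμ
        · left; intro y hy
          have : (-1 : ℝ) ≤ μ ℓ := by exact_mod_cast hμ
          linarith [(hy ℓ).1]
        · right; intro y hy
          have : (μ ℓ : ℝ) + 1 ≤ -1 := by exact_mod_cast (by omega : μ ℓ + 1 ≤ -1)
          linarith [(hy ℓ).2]
    rcases hlev with hle | hge
    · refine ⟨-((ε / 2) • intVec (normal4 ℓ)), 1, fun y hy hy' => ?_⟩
      rw [hatL, hcubo y hy hy', hS y, max_eq_right (by linarith [hle y hy']), inner_neg_left,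
        real_inner_smul_left]
      ring
    · refine ⟨0, 0, fun y hy hy' => ?_⟩
      rw [hatL, hcubo y hy hy', hS y, max_eq_left (by linarith [hge y hy']), inner_zero_left, add_zero]

/-- **The hole hat function is affine on every (hole-centred) closed chamber**
`{κ_i ≤ y_i ≤ κ_i + 1, 2ν_j − 1 ≤ ⟪a_j, y⟫ ≤ 2ν_j + 1}`. -/
theorem exists_affine_hatH (κ : Fin 3 → ℤ) (ν : Fin 4 → ℤ) :
    ∃ g : EuclideanSpace ℝ (Fin 3), ∃ b : ℝ, ∀ y : EuclideanSpace ℝ (Fin 3),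
      (∀ i, (κ i : ℝ) ≤ y i ∧ y i ≤ κ i + 1) →
      (∀ j, 2 * (ν j : ℝ) - 1 ≤ ⟪intVec (normal4 j), y⟫ ∧ ⟪intVec (normal4 j), y⟫ ≤ 2 * ν j + 1) →
      hatH y = ⟪g, y⟫ + b := by
  classical
  set σ : Fin 3 → ℝ := fun i => if 0 ≤ κ i then (1 : ℝ) else -1 with hσ
  have hσ1 : ∀ i, σ i = 1 ∨ σ i = -1 := fun i => by
    simp only [hσ]; split_ifs <;> simp
  have habs : ∀ y : EuclideanSpace ℝ (Fin 3), (∀ i, (κ i : ℝ) ≤ y i ∧ y i ≤ κ i + 1) →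
      ∀ i, |y i| = σ i * y i := fun y hy i => abs_eq_sign_mul hy i
  obtain ⟨ℓ, ε, hε, hSε⟩ := exists_normal4_of_signs σ hσ1
  have hS : ∀ y : EuclideanSpace ℝ (Fin 3), (∀ i, (κ i : ℝ) ≤ y i ∧ y i ≤ κ i + 1) →
      |y 0| + |y 1| + |y 2| = ε * ⟪intVec (normal4 ℓ), y⟫ := by
    intro y hy; rw [habs y hy 0, habs y hy 1, habs y hy 2, inner_intVec_left, hSε 0, hSε 1, hSε 2]; ring
  have hlev : (∀ y : EuclideanSpace ℝ (Fin 3),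
      (∀ j, 2 * (ν j : ℝ) - 1 ≤ ⟪intVec (normal4 j), y⟫ ∧ ⟪intVec (normal4 j), y⟫ ≤ 2 * ν j + 1) →
        ε * ⟪intVec (normal4 ℓ), y⟫ ≤ 1) ∨
      (∀ y : EuclideanSpace ℝ (Fin 3),
      (∀ j, 2 * (ν j : ℝ) - 1 ≤ ⟪intVec (normal4 j), y⟫ ∧ ⟪intVec (normal4 j), y⟫ ≤ 2 * ν j + 1) →
        1 ≤ ε * ⟪intVec (normal4 ℓ), y⟫) := by
    rcases hε with rfl | rfl
    · rcases le_or_gt (ν ℓ) 0 with hν | hν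
      · left; intro y hy
        have : (ν ℓ : ℝ) ≤ 0 := by exact_mod_cast hν
        linarith [(hy ℓ).2]
      · right; intro y hy
        have : (1 : ℝ) ≤ ν ℓ := by exact_mod_cast hν
        linarith [(hy ℓ).1]
    · rcases le_or_gt 0 (ν ℓ) with hν | hν
      · left; intro y hy
        have : (0 : ℝ) ≤ ν ℓ := by exact_mod_cast hν
        linarith [(hy ℓ).1]
      · right; intro y hy
        have : (ν ℓ : ℝ) ≤ -1 := by exact_mod_cast (by omega : ν ℓ ≤ -1)
        linarith [(hy ℓ).2]
  rcases hlev with hle | hge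
  · refine ⟨-(ε • intVec (normal4 ℓ)), 1, fun y hy hy' => ?_⟩
    rw [hatH, hS y hy, max_eq_right (by linarith [hle y hy']), inner_neg_left, real_inner_smul_left]
    ring
  · refine ⟨0, 0, fun y hy hy' => ?_⟩
    rw [hatH, hS y hy, max_eq_left (by linarith [hge y hy']), inner_zero_left, add_zero]

end Summit.Ventures.Crystal3D.TentCertificate

end
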